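import Mathlib
import Summits.MatrixMultiplication.MatrixMultiplication.Theorems.SnSubsetDichotomyPolynomialSlackScatteredAbsurd
import Summits.MatrixMultiplication.MatrixMultiplication.Theorems.SnSubsetDichotomyPolynomialSlackAtomBasicFacts

/-!
# The trichotomy cover of the kept value (3/4 step)

Crux `Summit.MatrixMultiplication.MatrixMultiplication.Theses.SnSubsetDichotomy.PolynomialSlack`
(item `stmt-MatrixMultiplication-8306`), level-one programme, line transport-split-hull (lead c10).
For a TPP triple with quotient profiles `dA, dB, dC` and the heavy part `pC` of the sparse profile at a
threshold `θC ≥ 16/n` (heavy mass `≤ Λ`), the level-one kept value of `kept_split_C`,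
`K = -(n-1) Σ_{i,j,k} (dA(i,j) - 1/n)(dB(j,k) - 1/n) pC(k,i)`, splits over the CELLS `(k,i)`:
`K = Σ_{k,i} c(k,i)`, `c(k,i) = (n-1) pC(k,i) Σ_j dB(j,k)(1/n - dA(i,j)) = (n-1) pC(k,i)(1/n - Σ_j dA dB)
  = (n-1) pC(k,i) Σ_j dA(i,j)(1/n - dB(j,k))` (unit row sums of `dA`, unit column sums of `dB`), and
`c ≤ pC`.  Call a heavy cell `ε`-DEPLETED if `n Σ_j dA dB ≤ 1 - ε`; the other heavy cells keep `≤ ε pC`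
(total `≤ ε Λ`).  Let `R` be the rows (U-positions) whose depleted mass is `≥ τ` and `Q` the columns
(S-positions) whose depleted mass OUTSIDE the `R`-rows is `≥ τ` (`|R| τ, |Q| τ ≤ Λ`).  The depleted cells
outside the `R`-rows and the `Q`-columns have all row and column sums `< τ`, so by
`scattered_cells_absurd` their mass is `< 1/100` when `300 τ Φ < 1`.  Hence
`K ≤ Σ_{k∈R} (kept of row k without the Q-columns) + Σ_{i∈Q} (kept of the full column i) + 1/100 + ε Λ`,
the column kept being written in the REVERSED form `(n-1) Σ_k pC(k,i) Σ_j dA(i,j)(1/n - dB(j,k))`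
(mask `∅`), ready for `hubRow_kept_le` applied to the reversed triple `(U, T, S)`.

The file is organised as: `rows_cols_peel` (the purely combinatorial peeling of hub rows and hub
columns off a nonnegative weight), `kept_cell_identity` (the cell identity `K = Σ c`),
`trichotomy_cover_core` (the cover for abstract profiles with unit marginals, the scattered bound being
a hypothesis) and the stub `trichotomy_cover` (which feeds in the marginal facts of the quotient
profiles and `scattered_cells_absurd`).
-/

namespace Summit.MatrixMultiplication.MatrixMultiplication.Theorems.PolynomialSlack

open scoped BigOperators
open Literature.Combinatorics.Additive (TripleProductProperty)

set_option linter.dupNamespace false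

/-! ## Peeling hub rows and hub columns off a weight -/

/-- **Rows/columns peeling.** For nonnegative weights `w` on the cells `(k, i)` and `τ > 0`, let `R`
be the rows of mass `≥ τ` and `Q` the columns whose mass outside the `R`-rows is `≥ τ`.  Then
`|R| τ ≤ Σ w`, `|Q| τ ≤ Σ w`, and the weight `p` obtained from `w` by zeroing the `R`-rows and the
`Q`-columns satisfies `0 ≤ p ≤ w`, has all row and column sums `≤ τ`, and agrees with `w` off the
`R`-rows and `Q`-columns. [folklore] -/
theorem rows_cols_peel {n : ℕ} (w : Fin n → Fin n → ℝ) (hw : ∀ k i, 0 ≤ w k i) (τ : ℝ)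
    (hτ : 0 < τ) :
    ∃ (R Q : Finset (Fin n)) (p : Fin n → Fin n → ℝ),
      (R.card : ℝ) * τ ≤ ∑ k, ∑ i, w k i ∧ (Q.card : ℝ) * τ ≤ ∑ k, ∑ i, w k i ∧
      (∀ k i, 0 ≤ p k i) ∧ (∀ k i, p k i ≤ w k i) ∧ (∀ k, ∑ i, p k i ≤ τ) ∧
      (∀ i, ∑ k, p k i ≤ τ) ∧ (∀ k i, k ∉ R → i ∉ Q → p k i = w k i) := by
  -- hub rows `R`, the weight `w'` off the hub rows, hub columns `Q`, the scattered weight `p`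
  obtain ⟨R, hR⟩ : ∃ R : Finset (Fin n), ∀ k, k ∈ R ↔ τ ≤ ∑ i, w k i :=
    ⟨Finset.univ.filter fun k => τ ≤ ∑ i, w k i, fun k => by simp⟩
  obtain ⟨w', hw'⟩ : ∃ w' : Fin n → Fin n → ℝ, ∀ k i, w' k i = if k ∈ R then 0 else w k i :=
    ⟨_, fun _ _ => rfl⟩
  obtain ⟨Q, hQ⟩ : ∃ Q : Finset (Fin n), ∀ i, i ∈ Q ↔ τ ≤ ∑ k, w' k i :=
    ⟨Finset.univ.filter fun i => τ ≤ ∑ k, w' k i, fun i => by simp⟩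
  obtain ⟨p, hp⟩ : ∃ p : Fin n → Fin n → ℝ, ∀ k i, p k i = if i ∈ Q then 0 else w' k i :=
    ⟨_, fun _ _ => rfl⟩
  have hw'0 : ∀ k i, 0 ≤ w' k i := fun k i => by
    rw [hw']; split_ifs; exacts [le_rfl, hw k i]
  have hw'le : ∀ k i, w' k i ≤ w k i := fun k i => by
    rw [hw']; split_ifs; exacts [hw k i, le_rfl]
  have hp0 : ∀ k i, 0 ≤ p k i := fun k i => by
    rw [hp]; split_ifs; exacts [le_rfl, hw'0 k i]
  have hple : ∀ k i, p k i ≤ w' k i := fun k i => by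
    rw [hp]; split_ifs; exacts [hw'0 k i, le_rfl]
  -- the rows of `w'` have mass `≤ τ`
  have hroww' : ∀ k, ∑ i, w' k i ≤ τ := fun k => by
    by_cases hk : k ∈ R
    · rw [Finset.sum_eq_zero fun i _ => by rw [hw', if_pos hk]]
      exact hτ.le
    · have e : ∑ i, w' k i = ∑ i, w k i := Finset.sum_congr rfl fun i _ => by rw [hw', if_neg hk]
      rw [e]
      exact (not_le.1 ((hR k).not.1 hk)).le
  refine ⟨R, Q, p, ?_, ?_, hp0, fun k i => (hple k i).trans (hw'le k i), fun k => ?_, fun i => ?_,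
    fun k i hk hi => by rw [hp, if_neg hi, hw', if_neg hk]⟩
  · calc (R.card : ℝ) * τ = ∑ k ∈ R, τ := by rw [Finset.sum_const, nsmul_eq_mul]
      _ ≤ ∑ k ∈ R, ∑ i, w k i := Finset.sum_le_sum fun k hk => (hR k).1 hk
      _ ≤ ∑ k, ∑ i, w k i := Finset.sum_le_sum_of_subset_of_nonneg (Finset.subset_univ R)
          fun k _ _ => Finset.sum_nonneg fun i _ => hw k i
  · calc (Q.card : ℝ) * τ = ∑ i ∈ Q, τ := by rw [Finset.sum_const, nsmul_eq_mul]
      _ ≤ ∑ i ∈ Q, ∑ k, w' k i := Finset.sum_le_sum fun i hi => (hQ i).1 hi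
      _ ≤ ∑ i, ∑ k, w' k i := Finset.sum_le_sum_of_subset_of_nonneg (Finset.subset_univ Q)
          fun i _ _ => Finset.sum_nonneg fun k _ => hw'0 k i
      _ ≤ ∑ i, ∑ k, w k i := Finset.sum_le_sum fun i _ => Finset.sum_le_sum fun k _ => hw'le k i
      _ = ∑ k, ∑ i, w k i := Finset.sum_comm
  · exact (Finset.sum_le_sum fun i _ => hple k i).trans (hroww' k)
  · by_cases hi : i ∈ Q
    · rw [Finset.sum_eq_zero fun k _ => by rw [hp, if_pos hi]]
      exact hτ.le
    · have e : ∑ k, p k i = ∑ k, w' k i := Finset.sum_congr rfl fun k _ => by rw [hp, if_neg hi]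
      rw [e]
      exact (not_le.1 ((hQ i).not.1 hi)).le

/-! ## The cell identity -/

/-- **Cell identity.** With unit row sums of `dA` and unit column sums of `dB`,
`-(n-1) Σ_{i,j,k} (dA(i,j) - 1/n)(dB(j,k) - 1/n) pC(k,i)
  = Σ_k Σ_i (n-1) pC(k,i) (1/n - Σ_j dA(i,j) dB(j,k))`
(as `Σ_j (dA(i,j) - 1/n)(dB(j,k) - 1/n) = Σ_j dA(i,j) dB(j,k) - 1/n`). [folklore] -/
theorem kept_cell_identity {n : ℕ} (hn : 1 ≤ n) (dA dB pC : Fin n → Fin n → ℝ)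
    (hrowA : ∀ i, ∑ j, dA i j = 1) (hcolB : ∀ k, ∑ j, dB j k = 1) :
    -((n : ℝ) - 1) * ∑ i : Fin n, ∑ j : Fin n, ∑ k : Fin n,
        (dA i j - 1 / n) * (dB j k - 1 / n) * pC k i =
      ∑ k : Fin n, ∑ i : Fin n, ((n : ℝ) - 1) * pC k i * (1 / n - ∑ j, dA i j * dB j k) := by
  have hn0 : (n : ℝ) ≠ 0 := by exact_mod_cast (by omega : n ≠ 0)
  -- the sum over `j` at a fixed cell `(k, i)`
  have h1 : ∀ i k, ∑ j, (dA i j - 1 / n) * (dB j k - 1 / n) * pC k i =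
      (∑ j, dA i j * dB j k - 1 / n) * pC k i := by
    intro i k
    rw [← Finset.sum_mul]
    congr 1
    have e : ∀ j, (dA i j - 1 / n) * (dB j k - 1 / n) =
        dA i j * dB j k - 1 / n * dA i j - 1 / n * dB j k + 1 / n * (1 / n) := fun j => by ring
    rw [Finset.sum_congr rfl fun j _ => e j]
    simp only [Finset.sum_add_distrib, Finset.sum_sub_distrib]
    rw [Finset.sum_const, Finset.card_univ, Fintype.card_fin, nsmul_eq_mul, ← Finset.mul_sum,
      ← Finset.mul_sum, hrowA i, hcolB k]
    field_simp
    ring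
  calc -((n : ℝ) - 1) * ∑ i, ∑ j, ∑ k, (dA i j - 1 / n) * (dB j k - 1 / n) * pC k i
      = -((n : ℝ) - 1) * ∑ i, ∑ k, (∑ j, dA i j * dB j k - 1 / n) * pC k i := by
        congr 1
        refine Finset.sum_congr rfl fun i _ => ?_
        rw [Finset.sum_comm]
        exact Finset.sum_congr rfl fun k _ => h1 i k
    _ = ∑ i, ∑ k, ((n : ℝ) - 1) * pC k i * (1 / n - ∑ j, dA i j * dB j k) := by
        rw [Finset.mul_sum]
        refine Finset.sum_congr rfl fun i _ => ?_
        rw [Finset.mul_sum]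
        exact Finset.sum_congr rfl fun k _ => by ring
    _ = _ := Finset.sum_comm

/-! ## The cover for abstract profiles -/

/-- **Trichotomy cover, abstract form.** For nonnegative profiles `dA` (unit row sums) and `dB`
(unit column sums), nonnegative cell weights `pC` of total mass `≤ Λ`, `ε > 0`, `τ > 0`, and the
SCATTERED BOUND (every nonnegative weight supported on `ε`-depleted cells with all row and column
sums `≤ τ` has total `< 1/100`): there are `R, Q` with `|R| τ ≤ Λ`, `|Q| τ ≤ Λ` and
`-(n-1) Σ (dA-1/n)(dB-1/n) pC ≤ Σ_{k∈R} (n-1) Σ_{i∉Q} pC(k,i) Σ_j dB(j,k)(1/n - dA(i,j))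
  + Σ_{i∈Q} (n-1) Σ_{k∉∅} pC(k,i) Σ_j dA(i,j)(1/n - dB(j,k)) + (1/100 + ε Λ)`. [folklore] -/
theorem trichotomy_cover_core {n : ℕ} (hn : 2 ≤ n) (dA dB pC : Fin n → Fin n → ℝ)
    (hdA0 : ∀ i j, 0 ≤ dA i j) (hdB0 : ∀ j k, 0 ≤ dB j k)
    (hrowA : ∀ i, ∑ j, dA i j = 1) (hcolB : ∀ k, ∑ j, dB j k = 1) (hpC0 : ∀ k i, 0 ≤ pC k i)
    (Λ ε τ : ℝ) (hε : 0 < ε) (hτ : 0 < τ) (hpCsum : ∑ k, ∑ i, pC k i ≤ Λ)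
    (hscat : ∀ p : Fin n → Fin n → ℝ, (∀ k i, 0 ≤ p k i) → (∀ k, ∑ i, p k i ≤ τ) →
      (∀ i, ∑ k, p k i ≤ τ) → (∀ k i, 0 < p k i → (n : ℝ) * ∑ j, dA i j * dB j k ≤ 1 - ε) →
      ∑ k, ∑ i, p k i < 1 / 100) :
    ∃ R Q : Finset (Fin n), (R.card : ℝ) * τ ≤ Λ ∧ (Q.card : ℝ) * τ ≤ Λ ∧
      -((n : ℝ) - 1) * ∑ i : Fin n, ∑ j : Fin n, ∑ k : Fin n,
          (dA i j - 1 / n) * (dB j k - 1 / n) * pC k i ≤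
        ∑ k ∈ R, ((n : ℝ) - 1) * ∑ i ∈ Finset.univ.filter (fun i => i ∉ Q), pC k i *
            ∑ j : Fin n, dB j k * (1 / n - dA i j) +
        ∑ i ∈ Q, ((n : ℝ) - 1) * ∑ k ∈ Finset.univ.filter (fun k => k ∉ (∅ : Finset (Fin n))),
            pC k i * ∑ j : Fin n, dA i j * (1 / n - dB j k) +
        (1 / 100 + ε * Λ) := by
  have hn0 : (0 : ℝ) < n := by exact_mod_cast (by omega : 0 < n)
  have hn0' : (n : ℝ) ≠ 0 := hn0.ne'
  have hn1 : (0 : ℝ) ≤ (n : ℝ) - 1 := by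
    have : (2 : ℝ) ≤ n := by exact_mod_cast hn
    linarith
  -- the overlaps `s k i = Σ_j dA(i,j) dB(j,k)` and the cell values `c k i`
  obtain ⟨s, hs⟩ : ∃ s : Fin n → Fin n → ℝ, ∀ k i, s k i = ∑ j, dA i j * dB j k :=
    ⟨_, fun _ _ => rfl⟩
  obtain ⟨c, hc⟩ : ∃ c : Fin n → Fin n → ℝ, ∀ k i,
      c k i = ((n : ℝ) - 1) * pC k i * (1 / n - s k i) := ⟨_, fun _ _ => rfl⟩
  have hs0 : ∀ k i, 0 ≤ s k i := fun k i => by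
    rw [hs]; exact Finset.sum_nonneg fun j _ => mul_nonneg (hdA0 i j) (hdB0 j k)
  -- the two one-sided forms of the cell value
  have hXB : ∀ k i, ∑ j, dB j k * (1 / n - dA i j) = 1 / n - s k i := fun k i => by
    have e : ∀ j, dB j k * (1 / n - dA i j) = 1 / n * dB j k - dA i j * dB j k := fun j => by ring
    rw [Finset.sum_congr rfl fun j _ => e j, Finset.sum_sub_distrib, ← Finset.mul_sum, hcolB k, hs]
    ring
  have hXA : ∀ k i, ∑ j, dA i j * (1 / n - dB j k) = 1 / n - s k i := fun k i => by
    have e : ∀ j, dA i j * (1 / n - dB j k) = 1 / n * dA i j - dA i j * dB j k := fun j => by ring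
    rw [Finset.sum_congr rfl fun j _ => e j, Finset.sum_sub_distrib, ← Finset.mul_sum, hrowA i, hs]
    ring
  -- bounds on the cell values: `c ≤ pC` always, `c ≤ ε pC` on a non-depleted cell
  have hcle : ∀ k i, c k i ≤ pC k i := fun k i => by
    have h1 : ((n : ℝ) - 1) * pC k i * (1 / n - s k i) ≤ ((n : ℝ) - 1) * pC k i * (1 / n) :=
      mul_le_mul_of_nonneg_left (by linarith [hs0 k i]) (mul_nonneg hn1 (hpC0 k i))
    have h2 : ((n : ℝ) - 1) * pC k i * (1 / n) = pC k i - pC k i / n := by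
      field_simp
    have h3 : 0 ≤ pC k i / n := div_nonneg (hpC0 k i) hn0.le
    rw [hc]
    linarith
  have hceps : ∀ k i, ¬(n : ℝ) * s k i ≤ 1 - ε → c k i ≤ ε * pC k i := fun k i hd => by
    have hlt : 1 / (n : ℝ) - s k i < ε / n := by
      rw [lt_div_iff₀' hn0, mul_sub, mul_one_div_cancel hn0']
      linarith [not_le.1 hd]
    have h1 : ((n : ℝ) - 1) * pC k i * (1 / n - s k i) ≤ ((n : ℝ) - 1) * pC k i * (ε / n) :=
      mul_le_mul_of_nonneg_left hlt.le (mul_nonneg hn1 (hpC0 k i))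
    have h2 : ((n : ℝ) - 1) * pC k i * (ε / n) = ε * pC k i - ε * pC k i / n := by
      field_simp
    have h3 : 0 ≤ ε * pC k i / n := div_nonneg (mul_nonneg hε.le (hpC0 k i)) hn0.le
    rw [hc]
    linarith
  -- the depleted mass `w` and its peeling into hub rows `R`, hub columns `Q`, scattered part `p`
  obtain ⟨w, hw⟩ : ∃ w : Fin n → Fin n → ℝ, ∀ k i,
      w k i = if (n : ℝ) * s k i ≤ 1 - ε then pC k i else 0 := ⟨_, fun _ _ => rfl⟩
  have hw0 : ∀ k i, 0 ≤ w k i := fun k i => by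
    rw [hw]; split_ifs; exacts [hpC0 k i, le_rfl]
  have hwle : ∀ k i, w k i ≤ pC k i := fun k i => by
    rw [hw]; split_ifs; exacts [le_rfl, hpC0 k i]
  have hwsum : ∑ k, ∑ i, w k i ≤ Λ :=
    (Finset.sum_le_sum fun k _ => Finset.sum_le_sum fun i _ => hwle k i).trans hpCsum
  obtain ⟨R, Q, p, hRc, hQc, hp0, hple, hprow, hpcol, hpeq⟩ := rows_cols_peel w hw0 τ hτ
  -- the scattered part is supported on depleted cells, hence negligible
  have hpsmall : ∑ k, ∑ i, p k i < 1 / 100 := by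
    refine hscat p hp0 hprow hpcol fun k i hki => ?_
    have hwpos : 0 < w k i := hki.trans_le (hple k i)
    rw [hw] at hwpos
    split_ifs at hwpos with hd
    · rw [← hs]; exact hd
    · exact absurd hwpos (lt_irrefl 0)
  -- the pointwise cover of a cell value
  have hpt : ∀ k i, c k i ≤ (if k ∈ R then (if i ∉ Q then c k i else 0) else 0) +
      (if i ∈ Q then c k i else 0) + (ε * pC k i + p k i) := by
    intro k i
    have hε0 : 0 ≤ ε * pC k i := mul_nonneg hε.le (hpC0 k i)
    have hp0' := hp0 k i
    by_cases hi : i ∈ Q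
    · rw [if_pos hi, if_neg (not_not_intro hi), ite_self]
      linarith
    rw [if_neg hi, if_pos hi]
    by_cases hk : k ∈ R
    · rw [if_pos hk]
      linarith
    rw [if_neg hk, hpeq k i hk hi, hw]
    split_ifs with hd
    · linarith [hcle k i]
    · linarith [hceps k i hd]
  have hsum : ∑ k, ∑ i, c k i ≤ ∑ k, ∑ i, ((if k ∈ R then (if i ∉ Q then c k i else 0) else 0) +
      (if i ∈ Q then c k i else 0) + (ε * pC k i + p k i)) :=
    Finset.sum_le_sum fun k _ => Finset.sum_le_sum fun i _ => hpt k i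
  simp only [Finset.sum_add_distrib, ← Finset.mul_sum] at hsum
  -- identification of the hub-row group
  have hA : ∑ k ∈ R, ((n : ℝ) - 1) * ∑ i ∈ Finset.univ.filter (fun i => i ∉ Q), pC k i *
      ∑ j : Fin n, dB j k * (1 / n - dA i j) =
      ∑ k, ∑ i, (if k ∈ R then (if i ∉ Q then c k i else 0) else 0) := by
    have key : ∀ k, ((n : ℝ) - 1) * ∑ i ∈ Finset.univ.filter (fun i => i ∉ Q), pC k i *
        ∑ j : Fin n, dB j k * (1 / n - dA i j) = ∑ i, (if i ∉ Q then c k i else 0) := by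
      intro k
      rw [Finset.mul_sum, Finset.sum_filter]
      refine Finset.sum_congr rfl fun i _ => ?_
      by_cases hi : i ∉ Q
      · rw [if_pos hi, if_pos hi, hXB k i, hc]
        ring
      · rw [if_neg hi, if_neg hi]
    symm
    calc ∑ k, ∑ i, (if k ∈ R then (if i ∉ Q then c k i else 0) else 0)
        = ∑ k, (if k ∈ R then ∑ i, (if i ∉ Q then c k i else 0) else 0) := by
          refine Finset.sum_congr rfl fun k _ => ?_
          by_cases hk : k ∈ R
          · simp only [if_pos hk]
          · simp only [if_neg hk, Finset.sum_const_zero]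
      _ = ∑ k ∈ R, ∑ i, (if i ∉ Q then c k i else 0) := by
          rw [Finset.sum_ite_mem, Finset.univ_inter]
      _ = _ := Finset.sum_congr rfl fun k _ => (key k).symm
  -- identification of the hub-column group (reversed form, empty mask)
  have hB : ∑ i ∈ Q, ((n : ℝ) - 1) *
      ∑ k ∈ Finset.univ.filter (fun k => k ∉ (∅ : Finset (Fin n))),
        pC k i * ∑ j : Fin n, dA i j * (1 / n - dB j k) =
      ∑ k, ∑ i, (if i ∈ Q then c k i else 0) := by
    have hf : Finset.univ.filter (fun k : Fin n => k ∉ (∅ : Finset (Fin n))) = Finset.univ :=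
      Finset.filter_true_of_mem fun k _ => Finset.notMem_empty k
    have key : ∀ i, ((n : ℝ) - 1) *
        ∑ k ∈ Finset.univ.filter (fun k => k ∉ (∅ : Finset (Fin n))),
          pC k i * ∑ j : Fin n, dA i j * (1 / n - dB j k) = ∑ k, c k i := by
      intro i
      rw [hf, Finset.mul_sum]
      refine Finset.sum_congr rfl fun k _ => ?_
      rw [hXA k i, hc]
      ring
    symm
    calc ∑ k, ∑ i, (if i ∈ Q then c k i else 0) = ∑ i, ∑ k, (if i ∈ Q then c k i else 0) :=
          Finset.sum_comm
      _ = ∑ i, (if i ∈ Q then ∑ k, c k i else 0) := by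
          refine Finset.sum_congr rfl fun i _ => ?_
          by_cases hi : i ∈ Q
          · simp only [if_pos hi]
          · simp only [if_neg hi, Finset.sum_const_zero]
      _ = ∑ i ∈ Q, ∑ k, c k i := by rw [Finset.sum_ite_mem, Finset.univ_inter]
      _ = _ := Finset.sum_congr rfl fun i _ => (key i).symm
  -- the kept value is the sum of the cell values
  have hL : -((n : ℝ) - 1) * ∑ i : Fin n, ∑ j : Fin n, ∑ k : Fin n,
      (dA i j - 1 / n) * (dB j k - 1 / n) * pC k i = ∑ k, ∑ i, c k i := by
    rw [kept_cell_identity (by omega) dA dB pC hrowA hcolB]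
    exact Finset.sum_congr rfl fun k _ => Finset.sum_congr rfl fun i _ => by rw [hc, hs]
  refine ⟨R, Q, hRc.trans hwsum, hQc.trans hwsum, ?_⟩
  rw [hL, hA, hB]
  have hεΛ : ε * ∑ k, ∑ i, pC k i ≤ ε * Λ := mul_le_mul_of_nonneg_left hpCsum hε.le
  linarith

/-! ## The stub -/

/-- **Trichotomy cover of the kept value.** For a TPP triple `S, T, U ⊆ S_n` (`n ≥ 2`) with quotient
profiles `dA, dB, dC`, heavy part `pC` of `dC` at `θC ≥ 16/n` of total mass `≤ Λ`, `0 < ε ≤ 1`,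
`0 < τ` with `300 τ Φ < 1` (`Φ` the `ε`-matching bound): there are `R, Q ⊆ Fin n` with
`|R| τ ≤ Λ`, `|Q| τ ≤ Λ` and
`-(n-1) Σ (dA-1/n)(dB-1/n) pC ≤ Σ_{k∈R} (n-1) Σ_{i∉Q} pC(k,i) Σ_j dB(j,k)(1/n - dA(i,j))
  + Σ_{i∈Q} (n-1) Σ_{k∉∅} pC(k,i) Σ_j dA(i,j)(1/n - dB(j,k)) + (1/100 + ε Λ)`. [folklore] -/
theorem trichotomy_cover {n : ℕ} (hn : 2 ≤ n) {S T U : Finset (Equiv.Perm (Fin n))}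
    (hTPP : TripleProductProperty S T U) (hS0 : S.Nonempty) (hT0 : T.Nonempty) (hU0 : U.Nonempty)
    (dA dB dC pC : Fin n → Fin n → ℝ)
    (hdA : ∀ i j, dA i j =
      (((S ×ˢ T).filter fun st => st.2 j = st.1 i).card : ℝ) / (S.card * T.card : ℕ))
    (hdB : ∀ j k, dB j k =
      (((T ×ˢ U).filter fun tu => tu.2 k = tu.1 j).card : ℝ) / (T.card * U.card : ℕ))
    (hdC : ∀ k i, dC k i =
      (((U ×ˢ S).filter fun us => us.2 i = us.1 k).card : ℝ) / (U.card * S.card : ℕ))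
    (θC : ℝ) (hθC : 16 / (n : ℝ) ≤ θC)
    (hpC : ∀ k i, pC k i = if θC ≤ dC k i then dC k i - 1 / n else 0)
    (Λ ε τ : ℝ) (hε : 0 < ε) (hε1 : ε ≤ 1) (hτ : 0 < τ)
    (hmassC : ∑ k : Fin n, ∑ i : Fin n, (if θC ≤ dC k i then dC k i else 0) ≤ Λ)
    (hτΦ : 300 * τ * (576 * (1 + Real.log n) *
      (Real.log (8 * ((n.factorial : ℝ) / (S.card * T.card : ℕ)) /
          (ε ^ 2 / (12 * (1 + Real.log n) * (2 + Real.log (1 / ε))))) +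
        Real.log (8 * ((n.factorial : ℝ) / (T.card * U.card : ℕ)) /
          (ε ^ 2 / (12 * (1 + Real.log n) * (2 + Real.log (1 / ε)))))) /
      (ε ^ 2 / (12 * (1 + Real.log n) * (2 + Real.log (1 / ε)))) ^ 3) < 1) :
    ∃ R Q : Finset (Fin n), (R.card : ℝ) * τ ≤ Λ ∧ (Q.card : ℝ) * τ ≤ Λ ∧
      -((n : ℝ) - 1) * ∑ i : Fin n, ∑ j : Fin n, ∑ k : Fin n,
          (dA i j - 1 / n) * (dB j k - 1 / n) * pC k i ≤
        ∑ k ∈ R, ((n : ℝ) - 1) * ∑ i ∈ Finset.univ.filter (fun i => i ∉ Q), pC k i *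
            ∑ j : Fin n, dB j k * (1 / n - dA i j) +
        ∑ i ∈ Q, ((n : ℝ) - 1) * ∑ k ∈ Finset.univ.filter (fun k => k ∉ (∅ : Finset (Fin n))),
            pC k i * ∑ j : Fin n, dA i j * (1 / n - dB j k) +
        (1 / 100 + ε * Λ) := by
  have _ := hdC -- the `(U, S)` profile enters only through `pC` (`hpC`) and `hmassC`
  have hn0 : 0 < n := by omega
  -- nonnegativity and unit marginals of the profiles
  have hdA0 : ∀ i j, 0 ≤ dA i j := fun i j => by rw [hdA]; positivity
  have hdB0 : ∀ j k, 0 ≤ dB j k := fun j k => by rw [hdB]; positivity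
  have hrowA : ∀ i, ∑ j : Fin n, dA i j = 1 := fun i => by
    simp only [hdA]
    rw [← Finset.sum_div, ← Nat.cast_sum, sum_pairMarginal_snd S T i]
    have h0 : (0 : ℝ) < (S.card * T.card : ℕ) := by
      exact_mod_cast Nat.mul_pos hS0.card_pos hT0.card_pos
    exact div_self h0.ne'
  have hcolB : ∀ k, ∑ j : Fin n, dB j k = 1 := fun k => by
    simp only [hdB]
    rw [← Finset.sum_div, ← Nat.cast_sum, sum_pairMarginal_fst T U k]
    have h0 : (0 : ℝ) < (T.card * U.card : ℕ) := by
      exact_mod_cast Nat.mul_pos hT0.card_pos hU0.card_pos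
    exact div_self h0.ne'
  -- the heavy part `pC`: nonnegative, of total mass `≤ Λ`
  have hpC0 : ∀ k i, 0 ≤ pC k i := fun k i => kept_nonneg hn0 θC (dC k i) (pC k i) hθC (hpC k i)
  have hpCle : ∀ k i, pC k i ≤ if θC ≤ dC k i then dC k i else 0 := fun k i => by
    rw [hpC]
    split_ifs
    · have : (0 : ℝ) ≤ 1 / n := by positivity
      linarith
    · exact le_rfl
  have hpCsum : ∑ k, ∑ i, pC k i ≤ Λ :=
    (Finset.sum_le_sum fun k _ => Finset.sum_le_sum fun i _ => hpCle k i).trans hmassC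
  -- the scattered bound, from `scattered_cells_absurd`
  have hscat : ∀ p : Fin n → Fin n → ℝ, (∀ k i, 0 ≤ p k i) → (∀ k, ∑ i, p k i ≤ τ) →
      (∀ i, ∑ k, p k i ≤ τ) → (∀ k i, 0 < p k i → (n : ℝ) * ∑ j, dA i j * dB j k ≤ 1 - ε) →
      ∑ k, ∑ i, p k i < 1 / 100 := by
    intro p hp0 hrow hcol hdep
    by_contra hW
    exact scattered_cells_absurd hn hTPP hS0 hT0 hU0 dA dB hdA hdB ε hε hε1 p hp0 τ hτ hrow hcol
      (not_lt.1 hW) hdep hτΦ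
  exact trichotomy_cover_core hn dA dB pC hdA0 hdB0 hrowA hcolB hpC0 Λ ε τ hε hτ hpCsum hscat

end Summit.MatrixMultiplication.MatrixMultiplication.Theorems.PolynomialSlack
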